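import Summits.NavierStokesRegularity.NavierStokesRegularity.Theorems.SqueezeCycleStrainAlgebra

/-!
# Candidate proof of `stub_cubicProductionBound` (line quarter-bootstrap-pinning, crux
`ExtremalBiaxialitySubcritical`, stmt-NavierStokesRegularity-11609) — drefute evidence

Statement VERBATIM the registered stub (skeleton sha 994055e8). Proof: `production_identity`
(`−4 det S = μσ − ½μ³`, `μ = eigenvalues₀ 1` of `A + Aᵀ`, `σ = |S|²_F`) and `six_mul_midStrain_sq_le`
(`(3/2)μ² ≤ σ`), then a square-root-free case split: (A) `6m² ≤ σ`:
`K²(m − μ/2)(2σ − 4(m² + mμ/2 + μ²/4)) + 4m³(K² − σ) ≥ 0`; (B) `σ < 6m²`: `4m³σ ≤ (2/3)mK²σ` and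
`G = (4/3)mσ − μσ + ½μ³ ≥ 0` by the three sub-cases `μ ≤ 0`, `0 < μ ≤ 4m/3`,
`μ > 4m/3` (where `6m²(4m/3 − μ) + ½μ³ = (μ − 2m)²(μ/2 + 2m)`). Tight at the axisymmetric shape
`σ = K² = 6m²`, `μ = 2m`.
-/

namespace Summit.NavierStokesRegularity.NavierStokesRegularity.Cruxes.ExtremalBiaxialitySubcritical.DrefuteQBP

open Summit.NavierStokesRegularity.NavierStokesRegularity.Theorems
open scoped Matrix

/-- **`stub_cubicProductionBound`** (verbatim signature), proved. -/
theorem stub_cubicProductionBound_proof :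
    ∀ (A : Matrix (Fin 3) (Fin 3) ℝ) (m K : ℝ), A.trace = 0 → 0 ≤ m → 0 < K → 6 * m ^ 2 ≤ K ^ 2 → (Matrix.isHermitian_add_transpose_self A).eigenvalues₀ 1 ≤ 2 * m → (∑ i, ∑ j, (((1 / 2 : ℝ) • (A + Aᵀ)) i j) ^ 2) ≤ K ^ 2 → -4 * (((1 / 2 : ℝ) • (A + Aᵀ))).det ≤ (2 * m - 4 * m ^ 3 / K ^ 2) * (∑ i, ∑ j, (((1 / 2 : ℝ) • (A + Aᵀ)) i j) ^ 2) := by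
  intro A m K hA hm hK h6K hmid hσK
  rw [production_identity A hA]
  have h6 := six_mul_midStrain_sq_le A hA
  set μ := (Matrix.isHermitian_add_transpose_self A).eigenvalues₀ 1 with hμ
  set σ := ∑ i, ∑ j, (((1 / 2 : ℝ) • (A + Aᵀ)) i j) ^ 2 with hσ
  have hK2 : 0 < K ^ 2 := by positivity
  have hσ0 : 0 ≤ σ := by rw [hσ]; positivity
  -- clear the denominator
  have hgoal : (μ * σ - 1 / 2 * μ ^ 3) * K ^ 2 ≤ (2 * m * K ^ 2 - 4 * m ^ 3) * σ := by
    by_cases hcase : 6 * m ^ 2 ≤ σ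
    · -- (A): RHS − LHS = K²(m − μ/2)(2σ − 4(m² + mμ/2 + μ²/4)) + 4m³(K² − σ)
      have hl : μ / 2 ≤ m := by linarith
      have hq : 0 ≤ 2 * σ - 4 * (m ^ 2 + m * (μ / 2) + (μ / 2) ^ 2) := by
        nlinarith [sq_nonneg (m - μ / 2)]
      have p1 : 0 ≤ K ^ 2 * ((m - μ / 2) * (2 * σ - 4 * (m ^ 2 + m * (μ / 2) + (μ / 2) ^ 2))) :=
        mul_nonneg hK2.le (mul_nonneg (sub_nonneg.2 hl) hq)
      have p2 : 0 ≤ 4 * m ^ 3 * (K ^ 2 - σ) := mul_nonneg (by positivity) (sub_nonneg.2 hσK)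
      nlinarith [p1, p2]
    · -- (B): σ < 6m²
      rw [not_le] at hcase
      have hG : 0 ≤ 4 / 3 * m * σ - μ * σ + 1 / 2 * μ ^ 3 := by
        rcases le_or_gt μ 0 with hμ0 | hμ0
        · -- μ ≤ 0: −μσ ≥ −μ·(3/2)μ² since −μ ≥ 0 and σ ≥ (3/2)μ²
          have p : 0 ≤ (-μ) * (σ - 3 / 2 * μ ^ 2) := mul_nonneg (by linarith) (by linarith)
          have p' : 0 ≤ (-μ) ^ 3 := pow_nonneg (by linarith) 3
          nlinarith [mul_nonneg hm hσ0, p, p']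
        · rcases le_or_gt μ (4 / 3 * m) with hμm | hμm
          · -- 0 < μ ≤ 4m/3
            have p : 0 ≤ (4 / 3 * m - μ) * σ := mul_nonneg (by linarith) hσ0
            have p' : 0 ≤ μ ^ 3 := pow_nonneg hμ0.le 3
            nlinarith [p, p']
          · -- μ > 4m/3: σ(4m/3 − μ) > 6m²(4m/3 − μ) and 6m²(4m/3 − μ) + ½μ³ = (μ − 2m)²(μ/2 + 2m)
            have p : 0 ≤ (μ - 4 / 3 * m) * (6 * m ^ 2 - σ) := mul_nonneg (by linarith) (by linarith)
            have p' : 0 ≤ (μ - 2 * m) ^ 2 * (μ / 2 + 2 * m) := mul_nonneg (sq_nonneg _) (by linarith)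
            nlinarith [p, p']
      have p1 : 0 ≤ K ^ 2 * (4 / 3 * m * σ - μ * σ + 1 / 2 * μ ^ 3) := mul_nonneg hK2.le hG
      have p2 : 0 ≤ m * σ * (2 / 3 * K ^ 2 - 4 * m ^ 2) :=
        mul_nonneg (mul_nonneg hm hσ0) (by linarith)
      nlinarith [p1, p2]
  have hrew : (2 * m - 4 * m ^ 3 / K ^ 2) * σ = (2 * m * K ^ 2 - 4 * m ^ 3) * σ / K ^ 2 := by
    field_simp
  rw [hrew, le_div_iff₀ hK2]
  exact hgoal

end Summit.NavierStokesRegularity.NavierStokesRegularity.Cruxes.ExtremalBiaxialitySubcritical.DrefuteQBP
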